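import Summits.QuantumFields.YangMills.Theorems.BalabanUVNodesK0RecordFormatNamesLemmas4
import Summits.QuantumFields.YangMills.Theorems.BalabanUVNodesPortS1Selector

/-!
# NODE O port PT-A, [RG-I] §2 (2.1) p. 265 ∕ (0.19) p. 255 — ROW S2-A, RECEIPTS: the (S1) functional of record `recordΦfAx` UNFOLDED to print's objects.
# `Φf(B) = 𝓝_{k+1}(v; W_B)` with `W_B = unitField B` (the SAME `W_B` whose rooted background `U_{k+1}(W_B) = recordBgField B` the chart side reads), and
# `𝓝_{k+1}(W) = A_{k+1}(W) − A_k(Ū^k(U_k-choice(W)))` with `A_{k+1}(W) = log(𝐍_k⁻¹ · (T_k χ_k e^{−G∕g_k² + A_k})(W))` — the fluctuation integral (2.1) in the tree's (0.19) body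

Cell `ym-nodeO-ideate`, porter seat `ymgap-nodeO-port-PTA-1` (gen 2); `--supports stmt-QuantumFields-27930`; PORT-PLAN v2 row S2-A (first receipts; the identity (2.12) itself is gen 3+).
[I] = [Balaban1987RG1].  DEPENDENT row in CRIT-1's Q-5 sense (reads `recordΦfAx`, the [Ax-4] name ✓p797304 — frozen), filed as receipts only.

CONTENTS.  §1 `recordΦfAx_eq_mergedTermT_unitField` — `Φf n B` IS the merged term `𝓝_{k+1}` of `Node00/BackgroundActionT` (transport `TβOfRecord₁₃`, cut-off `chiβOfRecord₁₃Ax θ`,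
history `extd v`) AT THE CHARTED CONFIGURATION `unitField F θ k K B` (`rfl`); §2 `mergedTermT_eq_log_sub` — `𝓝_{k+1}(W) = log(𝐍_k⁻¹ · T_k(ρ_k)(W)) − A_k(Ū^k(Uk … W))`, the (0.19)
body (`nextAction_apply`); §3 `recordΦfAx_eq_log_sub` — both together: the LEFT side of the residue's (f′) in print's letters (2.1).  LOCATED REMARK (no ruling asked): the subtracted
term reads the BARE choice `Uk F 2 K (k+1) θ.εbg` while the chart side reads the ROOTED selector `UkSel` (`recordBgField`); both lie in one residual orbit under TokE's
`UniqueUkOrbit`, the pieces are blind to the gauge (`…PortS1Assembly` §2) and `A_k ∘ Ū^k` is residual-invariant on the domain (def-T `HInvT`), so (f′) is well-posed — bookkeeping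
for gen 3's S2-A.

HONEST FRAMING.  `rfl`-level receipts; nothing of Bałaban's (2.1)–(2.14) asserted, ported or discharged; 27930 OPEN; K0⁷ NOT closed; NODE O 0∕1; COUNT 8∕28 · K 1∕4 UNMOVED; finite
`𝕋⁴_{L^K}` at fixed ε — NOT continuum ∕ OS ∕ Clay; **the Yang–Mills mass gap is NOT proved by any of this.**  No `sorry`, no `def`, no `instance`; standard axioms.
-/

noncomputable section

open scoped BigOperators Matrix.Norms.L2Operator Topology

namespace Summit.QuantumFields.YangMills.Theorems.BalabanUVNodesPortS1

open Summit.QuantumFields.YangMills.Theorems.K0RecordFormatNames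
open Literature.MathematicalPhysics.QuantumFieldTheory.Balaban1983to89
open Literature.MathematicalPhysics.QuantumFieldTheory.Balaban1983to89.Node00
open Literature.MathematicalPhysics.QuantumFieldTheory.Balaban1983to89.T4Continuum (T4Family)
open NormedSpace (exp)

variable (F : T4Family)

/-! ## §1  `Φf(B) = 𝓝_{k+1}(v; W_B)` at the charted configuration `W_B = unitField B` -/

/-- **`recordΦfAx … B` IS THE MERGED TERM `𝓝_{k+1}` AT `W_B = unitField F θ k K B`** (history `extd v`, transport `TβOfRecord₁₃`, cut-off `chiβOfRecord₁₃Ax θ`, radius `θ.εbg`),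
complexified — `rfl` through `ΦfOf`, `expChart`, `mergedTermFamilyMatT`, `mergedTermFamilyT`, `readField`, `unitField`. [cite: Balaban1987RG1, (1.6) p.261, (1.20) p.264, (2.1) p.265] -/
theorem recordΦfAx_eq_mergedTermT_unitField (a₀ ε₂₉ : ℝ) (k : ℕ) (v : Fin (k + 1) → ℝ) (K : ℕ) (B : recordW F a₀ ε₂₉ k K) :
    recordΦfAx F a₀ ε₂₉ k v K B =
      (letI θ := thetaFill F a₀ ε₂₉
       letI := θ.instVβ₁; letI := θ.instVβ₂
       ((mergedTermT F 2 (TβOfRecord₁₃ F 2) (chiβOfRecord₁₃Ax F 2 θ) θ.εbg K (T4FlagMemory.extd v) k (unitField F θ k K B) : ℝ) : ℂ)) := rfl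

/-! ## §2  `𝓝_{k+1}(W) = log(𝐍_k⁻¹ · (T_k ρ_k)(W)) − A_k(Ū^k(U-choice(W)))` — the (0.19) body -/

variable {F} in
/-- **The merged term in print's letters**: `𝓝_{k+1}(g; W) = log(𝐍_k⁻¹ · T_k(χ_k · exp[−(1∕g_k²) G + A_k])(W)) − A_k(Ū^k(U_k-choice(W)))` for ANY transport `T`, cut-off family `χ`
and radius `ε` — the fluctuation integral (2.1) in the tree's push-forward reading (0.19), minus the previous action at the averaged minimiser ((1.6)).
[cite: Balaban1987RG1, (2.1) p.265, (0.19) p.255, (1.6) p.261] -/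
theorem mergedTermT_eq_log_sub {N : ℕ} [NeZero N] (T : Transport F N) (χ : (K : ℕ) → (ℕ → ℝ) → (k : ℕ) → Density (F.P K) k (SU N))
    (ε : ℝ) (K : ℕ) (g : ℕ → ℝ) (k : ℕ) (W : GaugeField (F.P K) (k + 1) (SU N)) :
    mergedTermT F N T χ ε K g k W =
      Real.log ((normConstHT F N T χ K g k)⁻¹ *
          T K k (B12Eq019ActionBody.integrand (χ K g k) (gfOfRecord F N K k) (g k) (effActionHT F N T χ K g k)) W) -
        effActionHT F N T χ K g k (Averaging.iter (avOfRecord F N K) k (Uk F N K (k + 1) ε W)) := by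
  rw [mergedTermT, effActionHT_succ, B12Eq019ActionBody.nextAction_apply]
  rfl

/-! ## §3  The left side of the residue's (f′), unfolded -/

/-- **THE LEFT SIDE OF (f′) IN PRINT's LETTERS**: `recordΦfAx … k v K B = log(𝐍_k⁻¹ · (T_k ρ_k)(W_B)) − A_k(Ū^k(Uk(W_B)))` with `W_B = unitField B`, `T_k = TβOfRecord₁₃`,
`ρ_k = χ^{Ax}_k · exp[−(1∕g_k²) G + A_k]`, `g = extd v`, complexified. [cite: Balaban1987RG1, (2.1) p.265, (0.19) p.255, (1.6) p.261] -/
theorem recordΦfAx_eq_log_sub (a₀ ε₂₉ : ℝ) (k : ℕ) (v : Fin (k + 1) → ℝ) (K : ℕ) (B : recordW F a₀ ε₂₉ k K) :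
    recordΦfAx F a₀ ε₂₉ k v K B =
      (letI θ := thetaFill F a₀ ε₂₉
       letI := θ.instVβ₁; letI := θ.instVβ₂
       ((Real.log ((normConstHT F 2 (TβOfRecord₁₃ F 2) (chiβOfRecord₁₃Ax F 2 θ) K (T4FlagMemory.extd v) k)⁻¹ *
            TβOfRecord₁₃ F 2 K k
              (B12Eq019ActionBody.integrand (chiβOfRecord₁₃Ax F 2 θ K (T4FlagMemory.extd v) k) (gfOfRecord F 2 K k) (T4FlagMemory.extd v k)
                (effActionHT F 2 (TβOfRecord₁₃ F 2) (chiβOfRecord₁₃Ax F 2 θ) K (T4FlagMemory.extd v) k))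
              (unitField F θ k K B)) -
          effActionHT F 2 (TβOfRecord₁₃ F 2) (chiβOfRecord₁₃Ax F 2 θ) K (T4FlagMemory.extd v) k
            (Averaging.iter (avOfRecord F 2 K) k (Uk F 2 K (k + 1) θ.εbg (unitField F θ k K B))) : ℝ) : ℂ)) := by
  rw [recordΦfAx_eq_mergedTermT_unitField, mergedTermT_eq_log_sub]

/-- **The history letters**: at a flow prefix `v := FlowStep.prefixOf g k` (the ⁸ guard's reading) the coupling the (2.1) integrand reads is `g k` (`extd (prefixOf g k) k = g k`).
[cite: Balaban1987RG1, (0.20) p.256, (2.1) p.265 (bookkeeping)] -/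
theorem extd_prefixOf_at (g : ℕ → ℝ) (k : ℕ) : T4FlagMemory.extd (FlowStep.prefixOf g k) k = g k := by
  rw [T4FlagMemoryTwoRun.extd_prefixOf]
  simp

end Summit.QuantumFields.YangMills.Theorems.BalabanUVNodesPortS1

end
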